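import Summits.ResolutionOfSingularities.ResolutionOfSingularities.Theorems.HilbertSamuelEliminationSigmaMaxModificationsCorridor3WLadderShadowMDefs
import HarnessLib

/-!
# [OURS · L1 W4.2] MODULE `Corridor3WLadderShadowM` (crux chain w42, card C′ v3 MOVING splice) — part 2/2: the PROVED theorems

PROVENANCE / SPLIT FOR THE GATE (typer res-type-067): see `…Corridor3WLadderShadowMDefs` (part 1/2). This module = the PROVED
theorems of PART 1 of res-L1-w42-idea-1's `Sketch-L1-idea-1-C3.lean` (sha16 `ea42ede6917f0ca2`), byte-identical, original order, same
namespace: §1 `eq_of_noStep` / `exists_strictPlay` / `eventually_const_of_wf`, §2 `maxOriginNoMovingNearChainAtQ_of_shadowLawM` +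
doors `wtop3PointedM_of_shadowLawM` / `wtop3NonpointedM_of_shadowLawM` (conclude the tree's rows `Moving.Wtop3PointedM p` /
`Moving.Wtop3NonpointedM p` LITERALLY, no liveness hypothesis), §5 `wtop3PointedM_of_cPrime` / `wtop3NonpointedM_of_cPrime`.
OURS; NOT statements of the manuscript [Hironaka2017]; AI-drafted, AI review is weaker than expert review.
-/

noncomputable section

open CategoryTheory AlgebraicGeometry TopologicalSpace Topology Polynomial
open Literature.AlgebraicGeometry.Resolution
open Summit.ResolutionOfSingularities.ResolutionOfSingularities.Theorems.CampaignW42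

-- 0-warning rule of the gate (the summit namespace `ResolutionOfSingularities.ResolutionOfSingularities` is flagged by the linter)
set_option linter.dupNamespace false

namespace Summit.ResolutionOfSingularities.ResolutionOfSingularities.Theorems.SigmaMaxModificationsCorridor3.ShadowM

universe u

/-! ## §0. The tree's rows, by name -/

open Summit.ResolutionOfSingularities.ResolutionOfSingularities.Theorems.SigmaMaxModificationsCorridor3.Helpers (InScopeCQ QPointed)
open Summit.ResolutionOfSingularities.ResolutionOfSingularities.Theorems.SigmaMaxModificationsCorridor3.Moving
  (MaxOriginNoMovingNearChainAtQ Wtop3PointedM Wtop3NonpointedM)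

/-! ## §1. Compressing a lax play with infinitely many genuine steps (PROVED) -/

section Compress

variable {α : Type*} (r : α → α → Prop) (f : ℕ → α)

/-- Along a stretch with no genuine step the lax play stands still. [folklore] -/
theorem eq_of_noStep (hlax : ∀ n, r (f n) (f (n + 1)) ∨ f (n + 1) = f n) {a b : ℕ} (hab : a ≤ b)
    (hno : ∀ j, a ≤ j → j < b → ¬ r (f j) (f (j + 1))) : f b = f a := by
  induction b, hab using Nat.le_induction with
  | base => rfl
  | succ b hab ih =>
    have hb : f (b + 1) = f b := by
      rcases hlax b with h | h
      · exact absurd h (hno b hab (Nat.lt_succ_self b))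
      · exact h
    rw [hb]
    exact ih fun j hj hjb => hno j hj (Nat.lt_succ_of_lt hjb)

/-- **Compression** [OURS, folklore]: a lax `r`-play (each move is an `r`-step or stands still) with infinitely many `r`-steps
contains a strict `r`-play starting at the same state. -/
theorem exists_strictPlay (hlax : ∀ n, r (f n) (f (n + 1)) ∨ f (n + 1) = f n)
    (hio : ∀ n, ∃ m, n ≤ m ∧ r (f m) (f (m + 1))) :
    ∃ g : ℕ → α, g 0 = f 0 ∧ ∀ k, r (g k) (g (k + 1)) := by
  classical
  -- `φ k` = the `k`-th genuine step index
  let nxt : ℕ → ℕ := fun n => Nat.find (hio n)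
  have hnxt_le : ∀ n, n ≤ nxt n := fun n => (Nat.find_spec (hio n)).1
  have hnxt_step : ∀ n, r (f (nxt n)) (f (nxt n + 1)) := fun n => (Nat.find_spec (hio n)).2
  have hnxt_min : ∀ n j, n ≤ j → j < nxt n → ¬ r (f j) (f (j + 1)) := by
    intro n j hnj hj hr
    exact (Nat.find_min (hio n) hj) ⟨hnj, hr⟩
  let φ : ℕ → ℕ := fun k => Nat.rec (nxt 0) (fun _ m => nxt (m + 1)) k
  have hφ0 : φ 0 = nxt 0 := rfl
  have hφs : ∀ k, φ (k + 1) = nxt (φ k + 1) := fun k => rfl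
  refine ⟨fun k => f (φ k), ?_, ?_⟩
  · -- no step before `nxt 0`
    show f (φ 0) = f 0
    rw [hφ0]
    exact eq_of_noStep r f hlax (Nat.zero_le _) fun j hj hjb => hnxt_min 0 j hj hjb
  · intro k
    show r (f (φ k)) (f (φ (k + 1)))
    rw [hφs k]
    have hconst : f (nxt (φ k + 1)) = f (φ k + 1) :=
      eq_of_noStep r f hlax (hnxt_le _) fun j hj hjb => hnxt_min (φ k + 1) j hj hjb
    rw [hconst]
    cases k with
    | zero => rw [hφ0]; exact hnxt_step 0
    | succ k => rw [hφs k]; exact hnxt_step _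

end Compress

/-- An eventually-minimal value of a well-founded relation along a non-increasing sequence: if every move is a strict
`wlt`-descent or an equality, the sequence is eventually constant. [folklore] -/
theorem eventually_const_of_wf {W : Type*} {wlt : W → W → Prop} (hwf : WellFounded wlt) (g : ℕ → W)
    (hmono : ∀ n, wlt (g (n + 1)) (g n) ∨ g (n + 1) = g n) :
    ∃ n₀, ∀ k, g (n₀ + k) = g n₀ := by
  obtain ⟨w, ⟨n₀, rfl⟩, hmin⟩ := hwf.has_min (Set.range g) ⟨g 0, 0, rfl⟩
  refine ⟨n₀, fun k => ?_⟩
  induction k with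
  | zero => rfl
  | succ k ih =>
    rcases hmono (n₀ + k) with h | h
    · exact absurd (ih ▸ h) (hmin _ ⟨n₀ + k + 1, rfl⟩)
    · rw [Nat.add_succ, h, ih]

/-! ## §2 (continued). The PROVED reduction and the doors -/

/-- **REDUCTION (PROVED): a reading-valued shadow law gives the `Q`-restricted MOVING maximal-origin row.**
Proof: choose readings along the chain by the laws (dependent choice); the rank sequence is a lax descent in a well-founded
order, hence eventually constant; from then on genuine steps are shadow moves and waiting steps stand still; the chain is MOVING
(blown up infinitely often — data of the row), so compress (§1) to a strict good play; `terminates`. [folklore] -/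
theorem maxOriginNoMovingNearChainAtQ_of_shadowLawM {p N : ℕ} {Q : ℕ → (ℕ → ℕ) → ∀ X : Scheme.{u}, X → Prop}
    {G : MarkedStage.{u} → Prop} (L : ShadowLawM.{u} p N Q G) :
    MaxOriginNoMovingNearChainAtQ p N Q G := by
  classical
  intro R hF hA ν X hX x hx hq
  rintro ⟨c, h0, hstep, hG, hio⟩
  have hscope : ∀ n, InScopeCQ p R N ν Q (c n) := by
    intro n
    induction n with
    | zero => exact ⟨X, hX, x, hx, hq, h0⟩
    | succ n ih =>
      obtain ⟨X', h', x', hx', hq', hr⟩ := ih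
      exact ⟨X', h', x', hx', hq', hr.tail (hstep n)⟩
  -- dependent choice of readings
  have hsucc : ∀ n (st : L.St), L.reads R ν (c n) st → ∃ st', L.reads R ν (c (n + 1)) st' ∧
      (((c n).IsBlownUp R N ν → (L.step st st' ∧ (L.wlt (L.rk st') (L.rk st) ∨ L.rk st' = L.rk st)) ∨
        L.wlt (L.rk st') (L.rk st)) ∧ (¬ (c n).IsBlownUp R N ν → st' = st)) := by
    intro n st hst
    by_cases hb : (c n).IsBlownUp R N ν
    · obtain ⟨st', hst', h⟩ := L.law_moving R hF hA ν (c n) (c (n + 1)) (hscope n) (hG n) (hG (n + 1)) (hstep n) hb st hst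
      exact ⟨st', hst', fun _ => h, fun h' => absurd hb h'⟩
    · exact ⟨st, L.law_waiting R hF hA ν (c n) (c (n + 1)) (hscope n) (hG n) (hG (n + 1)) (hstep n) hb st hst,
        fun h' => absurd h' hb, fun _ => rfl⟩
  obtain ⟨st₀, hst₀⟩ := L.cover R hF hA ν (c 0) (hscope 0) (hG 0)
  let g : ∀ n : ℕ, {st : L.St // L.reads R ν (c n) st} :=
    fun n => Nat.rec ⟨st₀, hst₀⟩ (fun n ih => ⟨(hsucc n ih.1 ih.2).choose, (hsucc n ih.1 ih.2).choose_spec.1⟩) n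
  have hg : ∀ n, ((c n).IsBlownUp R N ν → (L.step (g n).1 (g (n + 1)).1 ∧
      (L.wlt (L.rk (g (n + 1)).1) (L.rk (g n).1) ∨ L.rk (g (n + 1)).1 = L.rk (g n).1)) ∨
        L.wlt (L.rk (g (n + 1)).1) (L.rk (g n).1)) ∧ (¬ (c n).IsBlownUp R N ν → (g (n + 1)).1 = (g n).1) :=
    fun n => (hsucc n (g n).1 (g n).2).choose_spec.2
  -- the rank sequence is a lax descent, hence eventually constant
  have hmono : ∀ n, L.wlt (L.rk (g (n + 1)).1) (L.rk (g n).1) ∨ L.rk (g (n + 1)).1 = L.rk (g n).1 := by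
    intro n
    by_cases hb : (c n).IsBlownUp R N ν
    · rcases (hg n).1 hb with h | h
      · exact h.2
      · exact Or.inl h
    · exact Or.inr (by rw [(hg n).2 hb])
  obtain ⟨n₀, hn₀⟩ := eventually_const_of_wf L.wf (fun n => L.rk (g n).1) hmono
  -- the tail from `n₀` is a lax play whose genuine steps are shadow moves
  have hirr : ∀ w, ¬ L.wlt w w := by
    intro w h
    obtain ⟨m, hm, hmin⟩ := L.wf.has_min {w} ⟨w, Set.mem_singleton w⟩
    rw [Set.mem_singleton_iff] at hm
    subst hm
    exact hmin _ (Set.mem_singleton _) h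
  let f : ℕ → L.St := fun k => (g (n₀ + k)).1
  have hgen : ∀ j, (c (n₀ + j)).IsBlownUp R N ν → L.step (f j) (f (j + 1)) := by
    intro j hb
    rcases (hg (n₀ + j)).1 hb with h | h
    · show L.step (g (n₀ + j)).1 (g (n₀ + j + 1)).1
      exact h.1
    · exfalso
      have h1 : L.rk (g (n₀ + j)).1 = L.rk (g n₀).1 := hn₀ j
      have h2 : L.rk (g (n₀ + j + 1)).1 = L.rk (g n₀).1 := hn₀ (j + 1)
      rw [h2, ← h1] at h
      exact hirr _ h
  have hlax : ∀ k, L.step (f k) (f (k + 1)) ∨ f (k + 1) = f k := by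
    intro k
    by_cases hb : (c (n₀ + k)).IsBlownUp R N ν
    · exact Or.inl (hgen k hb)
    · right
      show (g (n₀ + k + 1)).1 = (g (n₀ + k)).1
      exact (hg (n₀ + k)).2 hb
  have hio' : ∀ k, ∃ m, k ≤ m ∧ L.step (f m) (f (m + 1)) := by
    intro k
    obtain ⟨m, hm, hb⟩ := hio (n₀ + k)
    refine ⟨m - n₀, by omega, hgen (m - n₀) ?_⟩
    have hmm : n₀ + (m - n₀) = m := by omega
    rw [hmm]
    exact hb
  obtain ⟨g', hg'0, hg'⟩ := exists_strictPlay L.step f hlax hio'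
  refine L.terminates g' ?_ hg'
  rw [hg'0]
  exact L.fidelity R hF hA ν (c n₀) _ (hscope n₀) (hG n₀) (by simpa [f] using (g n₀).2)

/-- **DOOR (PROVED): the W-top-pointed MOVING row of the tree from a reading-valued shadow law from pointed origins.** [folklore] -/
theorem wtop3PointedM_of_shadowLawM {p : ℕ} (L : ShadowLawM.{u} p 3 QPointed fun s => 3 ≤ s.geomDirDim) : Wtop3PointedM.{u} p :=
  maxOriginNoMovingNearChainAtQ_of_shadowLawM L

/-- **DOOR (PROVED): the W-top-NONpointed MOVING row (THE CORE) from a reading-valued shadow law from non-pointed origins.** [folklore] -/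
theorem wtop3NonpointedM_of_shadowLawM {p : ℕ}
    (L : ShadowLawM.{u} p 3 (fun N ν X x => ¬ QPointed N ν X x) fun s => 3 ≤ s.geomDirDim) : Wtop3NonpointedM.{u} p :=
  maxOriginNoMovingNearChainAtQ_of_shadowLawM L

/-! ## §5 (continued). The PROVED row reductions from the C′ claims -/

/-- **ROW (PROVED reduction): `CPrime p QPointed ⇒ Moving.Wtop3PointedM p`.** [folklore] -/
theorem wtop3PointedM_of_cPrime {p : ℕ} (S : CPrime.{u} p QPointed) : Wtop3PointedM.{u} p :=
  wtop3PointedM_of_shadowLawM (shadowLawM_of_cPrime S)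

/-- **CORE ROW (PROVED reduction): `CPrime p ¬QPointed ⇒ Moving.Wtop3NonpointedM p`.** [folklore] -/
theorem wtop3NonpointedM_of_cPrime {p : ℕ} (S : CPrime.{u} p fun N ν X x => ¬ QPointed N ν X x) : Wtop3NonpointedM.{u} p :=
  wtop3NonpointedM_of_shadowLawM (shadowLawM_of_cPrime S)

end Summit.ResolutionOfSingularities.ResolutionOfSingularities.Theorems.SigmaMaxModificationsCorridor3.ShadowM

end
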